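import Summits.QuantumFields.YangMills.Theorems.BalabanUVNodesN08AlphaClassI
import Literature.MathematicalPhysics.QuantumFieldTheory.Balaban1983to89.B8Ineq132

/-!
# Route «BalabanUVNodes», Track-A DAG node N08 = [Balaban1985UV3] Thm 1 p. 257 ∕ Thm 2 p. 272 — THE (α) CLAUSE OF THE d = 3 LANE
# SPLIT BY SPECIES (part 2 of 2: the DISCHARGES): the four CLASS-I rows `h44 (+ floor) ∕ hLF67 ∕ h68 ∕ hU` of `UVStability3DInputs.RunAlpha`
# RE-DERIVED from the in-edges' printed statements with body ((43) + (44)'s loop input; [7] (3) = (42); [7] (2)∕(8); measurability), and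
# N08 at the C-binding of record over the constructed family from «DATA schema ∧ in-edge faces»

Cell `pub-ymgap`, seat `pub-ymgap-dag-n08-d` gen 0 (director-ym R134 row n08-d s1; census `HOME/pub-ymgap-dag-n08-b/N08-ALPHA-ROWS.md` 6a78a4e68c218d11 §2;
HUMAN RULING D-0062; chair R424 venue).  `bears_on: R4∕N08`; filed `--supports stmt-QuantumFields-19674`.  THEOREMS ONLY (def-free, sorry-free, standard
axioms) over part 1 `BalabanUVNodesN08AlphaClassI` (the schemas `StepDataRows ∕ OldTermForm ∕ RunDataRows`, `StepRowsI ∕ RunRowsI`, the faces `RegLift ∕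
InB42Lift ∕ HLarge ∕ InEdgeFaces`).

CONTENTS:
* §1 `h44_of_form43` ∕ `hfloor_of_form43` — (44) p. 267 and the degree floor FROM (43) and the loop-variable bound («and from (43) we get … (44)»),
  `B10SectCExpansion.bound44_of_shape43` BY NAME at the lane's old-term geometry `Carriers.oldGeom`.
* §2 `hLF67_of_inB42` — (67) ∘ the history's large-field condition FROM (42) = [7] (3): the four bonds of `∂p′`, `p′ ∈ P_j(h)`, have both end blocks
  in `Λ_j(h)` (`projSite_corner_mem_Lam` ⇐ `AdmissibleRegions.plaqCover_subset_of_admissible` ∘ `TorusLift.projSite_mem_plaqCover` ∘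
  `smul_corner_mem_deltaBox`), and the plaquette holonomy reads only them (`B7Prop1Local.hol_plaqWord_eq`); the converse bookkeeping
  `inB42_of_hLF67` (with `V_j := Ū^j(U_k)` the face IS the row: at the lane's granularity `hLF67`'s content beyond (42) is the history's
  large-field condition — recorded so that no strength is claimed for the ∃-face).
* §3 `h68_of_reg2` — (68) on `Δ′_j(p′)` FROM the scale-`j` plaquette clause of [7]'s (2)∕(8) over `Ω_j(h)`: every unit plaquette of the box of the four
  `j`-blocks at the corners of `p′` has its lower-left corner covered by `p′` (`mem_deltaBox_of_inBox`, `TorusLift.projSite_mem_plaqCover`), hence in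
  `Λ_j(h) ⊂ Ω_j(h)`; the box is finite (`B8Ineq132.pdevOn_lt_of_forall`).  Torus twin: `B10Eq68TorusRegularity.h68_of_regAt`.
* §4 `runRowsI_of_faces`, `runAlpha_of_data_faces : RunDataRows 𝔏 → InEdgeFaces 𝔏 → RunAlpha` — what remains DISPLAYED of the lane's (α) clause,
  once the in-edges' printed statements have bodies at its objects, is the cluster-expansion data (classes II + III) and (43)'s form.
* §5 N08 BY NAME over the split, through T4 (`BalabanUVNodesN08Constructed`): `b10Compact_constructedLE_of_faces`,
  `b10_main_constructedLE_upC_of_faces`, `b10_main_at_record_of_facesPin` (record-predicate form whose displayed clause is «DATA schema ∧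
  in-edge faces» — chair R434 (c1) idiom «ESTIMATE ASSUMED AS ADMISSIBILITY», the GAPS rows riding with the class-II names).
* §6 (v1.1) the lane's END THEOREM over the split: `uvStability3D_of_data_faces` (= `UVStability3DInputs.uvStability3D_of_inputs` with `RunAlpha`
  replaced by «`RunDataRows` ∧ `InEdgeFaces`» for every group and lattice approximation) and `not_literal_of_data_faces` (G-B10-01 on the same family).
HONEST FRAMING: count-neutral kernel bookkeeping; NOT a discharge of N08 (NODE 00 has not pinned `runs10` to the lane's towers nor `X.UkH` to [7]'s
minimizer); the class-II data stay hypotheses whose joint satisfiability on the constructed data is the lane's open programme; d = 3 lattice gauge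
theory on finite tori as printed; nothing about d = 4, the continuum, OS axioms, a mass gap or the Clay problem.
-/

noncomputable section

namespace Summit.QuantumFields.YangMills.Theorems.BalabanUVNodesN08AlphaClassIDischarge

open MeasureTheory Metric
open scoped BigOperators Matrix.Norms.L2Operator
open Literature.MathematicalPhysics.QuantumFieldTheory.Balaban1983to89
open Literature.MathematicalPhysics.QuantumFieldTheory.Balaban1983to89.B10
open Literature.MathematicalPhysics.QuantumFieldTheory.Balaban1983to89.B10SectCExpansion (Shape43 Bound44 TermSizes bound44_of_shape43)
open Literature.MathematicalPhysics.QuantumFieldTheory.Balaban1983to89.B10Eq70Squaring (deltaBox mem_deltaBox side)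
open Literature.MathematicalPhysics.QuantumFieldTheory.Balaban1985CMP102
open Literature.MathematicalPhysics.QuantumFieldTheory.Balaban1985CMP102.Setting
open Literature.MathematicalPhysics.QuantumFieldTheory.Balaban1983to89.DagBinding (leavesP WorldP PrintedCarriersR PrintedCarriers9X
  PrintedCarriers11 PrintedCarriers14R PrintedCarriers15)
open Literature.MathematicalPhysics.QuantumFieldTheory.Balaban1983to89.DagDischarged (b10Compact)
open Literature.MathematicalPhysics.QuantumFieldTheory.Balaban1983to89.B10CompactBinding (ofPrintedAllXPNC)
open Summit.QuantumFields.Balaban3D.Carriers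
open Summit.QuantumFields.Balaban3D.Proofs.Inputs
open Summit.QuantumFields.Balaban3D.Proofs.Primitives (AlphaConsts)
open Summit.QuantumFields.Balaban3D.Proofs.GroupModelLieC (lieC)
open Summit.QuantumFields.Balaban3D.Proofs.UVStability3DInputs
open Summit.QuantumFields.Balaban3D.Proofs.FamilyLE (ScalesLE)
open Summit.QuantumFields.Balaban3D.Proofs.ScalesArithmetic (gk_pos gk_le_one)
open Summit.QuantumFields.Balaban3D.Proofs.CouplingWindow (pFun_pos)
open Summit.QuantumFields.Balaban3D.Proofs.LiftBridge (liftCfg)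
open Summit.QuantumFields.Balaban3D.Proofs.Run3SmallFactors (codeZ decode_of_mem_disc)
open Summit.QuantumFields.Balaban3D.Proofs.TorusLift (projSite zOf projSite_mem_plaqCover)
open Summit.QuantumFields.Balaban3D.Proofs.AdmissibleRegions (plaqCover_subset_of_admissible)
open Summit.QuantumFields.YangMills.Theorems.BalabanUVNodesN08Constructed (b10Compact_constructedLE b10_main_constructedLE_upC)
open Summit.QuantumFields.YangMills.Theorems.BalabanUVNodesN08AlphaClassI
open B7Prop1Explicit (hol plaqWord e)
open B7Prop1Local (pdevOn loK plaqHiK InBox hol_plaqWord_eq)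
open B7Prop2Explicit (avgIter hol_plaqWord_self)
open B8Ineq132 (pdevOn_lt_of_forall)

variable {L : ℕ}

/-! ## §1–§4 The discharges of the class-I rows -/

section Faces

variable {S : Scales L} {G : Type} [GaugeGroup G] [MeasurableSpace G] [HaarData G] {𝔊 : GroupModel G} {𝔠 : AlphaConsts L 𝔊.N}
  {X : ExternalInputs S G} {𝔖 : ∀ k, StepSeries S G ↥(lieC 𝔊) (nblkOf S 𝔠.lane.carrier k) k} {𝔄 : AlphaData 𝔊 𝔠 X 𝔖}
  {𝔏 : OldTermSizes S G}

/-- **(44) FROM (43) AND THE LOOP-VARIABLE BOUND** («and from (43) we get … (44)», p. 267 L3–4): `B10SectCExpansion.bound44_of_shape43` BY NAME at the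
lane's old-term geometry. [cite: Balaban1985UV3, (43)–(44) pp.266–267] -/
theorem h44_of_form43 (k : ℕ) (F : OldTermForm 𝔊 𝔠 𝔖 𝔏 k)
    (hloop : ∀ (h : Hist S.P (k + 1)) (U : GaugeField S.P (k + 1) G), ∀ j ∈ Finset.Icc 1 k,
      ∀ (y : (oldGeom S.P k j).Site) (b : (oldGeom S.P k j).Bond),
        𝔏.loop k h U j y b ≤ ((ell S.P k j)⁻¹ * (oldGeom S.P k j).dist ((oldGeom S.P k j).cminus b) y) *
          (8 * (L : ℝ) ^ 2 * 𝔠.B₃ * S.gk k * pFun 𝔠.b₀ 𝔠.p₀ (S.gk k) * ell S.P k j ^ 2))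
    (h : Hist S.P (k + 1)) (U : GaugeField S.P (k + 1) G) (j : ℕ) (hj : j ∈ Finset.Icc 1 k) :
    Bound44 (oldGeom S.P k j) (fun y n c => (𝔖 k).oldVal h U j y n c) 𝔠.κ₁ (𝔠.M₁ : ℝ) (ell S.P k j) (L : ℝ) 𝔠.B₃
      (S.gk k) (pFun 𝔠.b₀ 𝔠.p₀ (S.gk k)) 𝔠.C44 :=
  bound44_of_shape43 (oldGeom S.P k j) (𝔏.coef k h U j) (fun y n c => (𝔖 k).oldVal h U j y n c) (𝔏.loop k h U j)
    𝔠.C44_nonneg (F.shape43 h U j hj) (F.loop_nonneg h U j hj) (hloop h U j hj) (F.mult43 h U j hj)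

/-- **THE DEGREE FLOOR «n ≥ 2» FROM (43)**: a non-zero evaluated term has a non-zero coefficient (multilinear evaluation), hence degree `≥ 2`.
[cite: Balaban1985UV3, (43) p.266 + p.267 L11] -/
theorem hfloor_of_form43 (k : ℕ) (F : OldTermForm 𝔊 𝔠 𝔖 𝔏 k) (h : Hist S.P (k + 1)) (U : GaugeField S.P (k + 1) G) (j : ℕ)
    (hj : j ∈ Finset.Icc 1 k) (y : Site S.P j) (n : ℕ) (c : Fin n → PBond S.P j) (hne : (𝔖 k).oldVal h U j y n c ≠ 0) : 2 ≤ n := by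
  refine (F.shape43 h U j hj).1 y n c fun hP => hne ?_
  have hm := F.mult43 h U j hj y n c
  rw [hP, abs_zero, zero_mul] at hm
  exact abs_eq_zero.1 (le_antisymm hm (abs_nonneg _))

/-- The scaled corners `L^j·(z + ae_μ + be_ν)`, `a, b ∈ {0,1}`, of a scale-`j` plaquette `(z; μ, ν)` lie in its box `Δ′_j` of (70) (lower-left corners of
the four corner blocks). [cite: Balaban1985UV3, (70) p.273] -/
theorem smul_corner_mem_deltaBox {d n : ℕ} (hn : 0 < n) (z : B7Prop1Explicit.Site d) {μ ν : Fin d} (hμν : μ ≠ ν) (a b : ℤ)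
    (ha : 0 ≤ a ∧ a ≤ 1) (hb : 0 ≤ b ∧ b ≤ 1) : n • (z + a • e μ + b • e ν) ∈ deltaBox n (n • z) μ ν := by
  rw [mem_deltaBox]
  intro κ
  have hn' : (0 : ℤ) < n := by exact_mod_cast hn
  have key : (n • (z + a • e μ + b • e ν) - n • z) κ = (n : ℤ) * (a * e μ κ + b * e ν κ) := by
    simp only [Pi.sub_apply, Pi.smul_apply, Pi.add_apply]
    simp only [nsmul_eq_mul, smul_eq_mul]
    ring
  rw [key, B7Prop1Explicit.e_apply μ κ, B7Prop1Explicit.e_apply ν κ]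
  unfold side
  by_cases hκμ : κ = μ
  · have hκν : κ ≠ ν := fun h' => hμν (hκμ.symm.trans h')
    rw [if_pos (Or.inl hκμ), if_pos hκμ, if_neg hκν]
    push_cast
    constructor <;> nlinarith [mul_le_mul_of_nonneg_left ha.2 hn'.le, mul_nonneg hn'.le ha.1]
  · by_cases hκν : κ = ν
    · rw [if_pos (Or.inr hκν), if_neg hκμ, if_pos hκν]
      push_cast
      constructor <;> nlinarith [mul_le_mul_of_nonneg_left hb.2 hn'.le, mul_nonneg hn'.le hb.1]
    · rw [if_neg (not_or.mpr ⟨hκμ, hκν⟩), if_neg hκμ, if_neg hκν]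
      constructor <;> nlinarith

/-- A site of the `B7Prop1Local` box `[L^j z, L^j z + (L^j − 1)𝟙 + L^j e_μ + L^j e_ν]` lies in `deltaBox L^j (L^j z) μ ν` of (70)
(`B10Eq69TorusPullback.mem_deltaBox_of_inBox` at a general base point). [cite: Balaban1985UV3, (70) p.273] -/
theorem mem_deltaBox_of_inBox {d : ℕ} (Lb j : ℕ) (z : B7Prop1Explicit.Site d) (μ ν : Fin d) {w : B7Prop1Explicit.Site d}
    (hw : InBox (loK Lb j z) (plaqHiK Lb j z μ ν) w) : w ∈ deltaBox (Lb ^ j) ((Lb ^ j) • z) μ ν := by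
  rw [mem_deltaBox]
  intro κ
  have h := hw κ
  simp only [loK, plaqHiK] at h
  have hsub : (w - (Lb ^ j) • z) κ = w κ - (Lb : ℤ) ^ j * z κ := by
    simp only [Pi.sub_apply, Pi.smul_apply]
    simp only [nsmul_eq_mul]
    push_cast
    ring
  rw [hsub]
  unfold side
  by_cases hκ : κ = μ ∨ κ = ν
  · rw [if_pos hκ] at h
    rw [if_pos hκ]
    push_cast
    constructor <;> linarith [h.1, h.2]
  · rw [if_neg hκ] at h
    rw [if_neg hκ]
    push_cast
    constructor <;> linarith [h.1, h.2]

/-- For an admissible history, the scaled corners of a recorded large-field plaquette `p′ ∈ P_j(h)` project into `Λ_j(h)` («Let us take a plaquette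
p′ ⊂ Λ_j», p. 273 L13; `AdmissibleRegions.plaqCover_subset_of_admissible` ∘ `TorusLift.projSite_mem_plaqCover`). [cite: Balaban1985UV3, p.273 L13] -/
theorem projSite_corner_mem_Lam {M₁ : ℕ} {Rcol : ℕ → ℕ} {k : ℕ} {h : Hist S.P k} (hh : Hist.Admissible M₁ Rcol k h) (hk : k ≤ S.K)
    {j : ℕ} (hj : j < k) {p : Plaq S.P j} (hp : p ∈ h ⟨j, hj⟩) (a b : ℤ) (ha : 0 ≤ a ∧ a ≤ 1) (hb : 0 ≤ b ∧ b ≤ 1) :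
    projSite ((L ^ j) • (zOf p + a • e p.μ + b • e p.ν)) ∈ Lam M₁ Rcol h j := by
  have hjm : j ≤ S.P.m + S.P.K := by show j ≤ S.m + S.K; omega
  have hcov := projSite_mem_plaqCover hjm p
    (smul_corner_mem_deltaBox (pow_pos S.P.L_pos j) (zOf p) (ne_of_lt p.hμν) a b ha hb)
  exact plaqCover_subset_of_admissible M₁ Rcol hh hj hp hcov

/-- **(67) ∘ LARGE FIELD FROM (42)** (p. 273 L13–14: «Let us take a plaquette p′ ⊂ Λ_j and such that |V_j(∂p′) − 1| ≥ g_jp(g_j). We have Ū_k^j = V_j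
on Λ_j, (67)»): if the lifted composite minimizer satisfies (42) for an `h`-large field history `V`, then at every recorded large-field plaquette
`|Ū_k^j(∂p′) − 1| = |V_j(∂p′) − 1| ≥ g_jp(g_j)` — the lane's row `hLF67`.  The four bonds of `∂p′` have both end blocks in `Λ_j(h)`
(`projSite_corner_mem_Lam`); the plaquette holonomy reads only them (`B7Prop1Local.hol_plaqWord_eq`). [cite: Balaban1985UV3, (67) p.273] -/
theorem hLF67_of_inB42 {k : ℕ} (hk : k ≤ S.K) {h : Hist S.P k}
    (hh : Hist.Admissible 𝔠.lane.carrier.M₁ (rcolOf S 𝔠.lane.carrier) k h) (U : GaugeField S.P k G)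
    {V : ℕ → B7Prop1Explicit.Site S.P.d → Fin S.P.d → (Matrix (Fin 𝔊.N) (Fin 𝔊.N) ℂ)ˣ}
    (hV : HLarge S 𝔠.lane.carrier.b₀ 𝔠.lane.carrier.p₀ h V)
    (h42 : InB42Lift S 𝔠.lane.carrier.M₁ (rcolOf S 𝔠.lane.carrier) h (liftCfg 𝔊 (X.UkH k h U)) V) :
    ∀ e ∈ Hist.disc h, S.gk e.1 * pFun 𝔠.lane.carrier.b₀ 𝔠.lane.carrier.p₀ (S.gk e.1) ≤
      ‖((hol (avgIter L (liftCfg 𝔊 (X.UkH k h U)) e.1) (codeZ e) (plaqWord e.2.2.1 e.2.2.2) :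
          (Matrix (Fin 𝔊.N) (Fin 𝔊.N) ℂ)ˣ) : Matrix (Fin 𝔊.N) (Fin 𝔊.N) ℂ) - 1‖ := by
  intro q hq
  obtain ⟨j, hj, p, hp, hqj, hz, hμ, hν⟩ := decode_of_mem_disc hq
  have hle := hV q hq
  have hq1 : q.1 = j := by rw [hqj]
  rw [hq1, hz, hμ, hν] at hle ⊢
  -- the four bonds of ∂p′ lie in Λ_j(h)
  have h01 : (0 : ℤ) ≤ 0 ∧ (0 : ℤ) ≤ 1 := ⟨le_rfl, zero_le_one⟩
  have h11 : (0 : ℤ) ≤ 1 ∧ (1 : ℤ) ≤ 1 := ⟨zero_le_one, le_rfl⟩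
  have c00 := projSite_corner_mem_Lam (S := S) hh hk hj hp 0 0 h01 h01
  have c10 := projSite_corner_mem_Lam (S := S) hh hk hj hp 1 0 h11 h01
  have c01 := projSite_corner_mem_Lam (S := S) hh hk hj hp 0 1 h01 h11
  have c11 := projSite_corner_mem_Lam (S := S) hh hk hj hp 1 1 h11 h11
  simp only [zero_smul, one_smul, add_zero] at c00 c10 c01 c11
  have b1 := h42 j hj (zOf p) p.μ c00 c10
  have b2 := h42 j hj (zOf p + e p.μ) p.ν c10 c11
  have b3 := h42 j hj (zOf p + e p.ν) p.μ c01 (by rwa [add_right_comm] at c11)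
  have b4 := h42 j hj (zOf p) p.ν c00 c01
  rw [hol_plaqWord_eq] at hle
  rw [hol_plaqWord_eq, b1, b2, b3, b4]
  exact hle

/-- **THE CONVERSE BOOKKEEPING (honesty note): the face `inB42` is NOT stronger than the row it discharges** — with the field history
`V_j := Ū^j(U_k(h, U))` itself, (42) holds trivially and the history's large-field condition `HLarge` IS the row `hLF67`; so at the lane's
granularity (field histories integrated out, `Carriers.Histories` F-p1-4) the content of `hLF67` beyond [7] (3) is exactly the history's condition on
the constraint data, and `inB42` only SEPARATES the in-edge clause (42) from it. [cite: Balaban1985UV3, (67) p.273 (bookkeeping)] -/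
theorem inB42_of_hLF67 {k : ℕ} {h : Hist S.P k} (U : GaugeField S.P k G)
    (hLF67 : ∀ e ∈ Hist.disc h, S.gk e.1 * pFun 𝔠.lane.carrier.b₀ 𝔠.lane.carrier.p₀ (S.gk e.1) ≤
      ‖((hol (avgIter L (liftCfg 𝔊 (X.UkH k h U)) e.1) (codeZ e) (plaqWord e.2.2.1 e.2.2.2) :
          (Matrix (Fin 𝔊.N) (Fin 𝔊.N) ℂ)ˣ) : Matrix (Fin 𝔊.N) (Fin 𝔊.N) ℂ) - 1‖) :
    ∃ V : ℕ → B7Prop1Explicit.Site S.P.d → Fin S.P.d → (Matrix (Fin 𝔊.N) (Fin 𝔊.N) ℂ)ˣ,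
      HLarge S 𝔠.lane.carrier.b₀ 𝔠.lane.carrier.p₀ h V ∧
        InB42Lift S 𝔠.lane.carrier.M₁ (rcolOf S 𝔠.lane.carrier) h (liftCfg 𝔊 (X.UkH k h U)) V :=
  ⟨fun j => avgIter L (liftCfg 𝔊 (X.UkH k h U)) j, hLF67, fun _ _ _ _ _ _ => rfl⟩

/-- **(68) ON `Δ′_j(p′)` FROM THE SCALE-`j` CLAUSE OF (2)** (p. 273 L14–16 «the configuration U_k satisfies the following regularity condition on
B^j(Λ_j): |U_k(∂p) − 1| < O(1)g_jp(g_j)L^{−2j} (68)»): every unit plaquette of the box of the four `j`-blocks at the corners of a recorded `p′ ∈ P_j(h)`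
has its lower-left corner covered by `p′`, hence in `Λ_j(h) ⊂ Ω_j(h)`, so the clause applies; the box is finite (`B8Ineq132.pdevOn_lt_of_forall`) — the
lane's row `h68`.  Torus twin: `B10Eq68TorusRegularity.h68_of_regAt`. [cite: Balaban1985UV3, (68) p.273] -/
theorem h68_of_reg2 {k : ℕ} (hk : k ≤ S.K) {h : Hist S.P k}
    (hh : Hist.Admissible 𝔠.lane.carrier.M₁ (rcolOf S 𝔠.lane.carrier) k h) (U : GaugeField S.P k G)
    (hreg : ∀ j < k, RegLift S j (Omega 𝔠.lane.carrier.M₁ (rcolOf S 𝔠.lane.carrier) k h j)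
      (𝔠.C68 * (S.gk j * pFun 𝔠.lane.carrier.b₀ 𝔠.lane.carrier.p₀ (S.gk j))) (liftCfg 𝔊 (X.UkH k h U))) :
    ∀ e ∈ Hist.disc h,
      pdevOn (loK L e.1 (codeZ e)) (plaqHiK L e.1 (codeZ e) e.2.2.1 e.2.2.2) (liftCfg 𝔊 (X.UkH k h U)) <
        𝔠.C68 * (S.gk e.1 * pFun 𝔠.lane.carrier.b₀ 𝔠.lane.carrier.p₀ (S.gk e.1)) * (((L : ℝ) ^ e.1)⁻¹) ^ 2 := by
  intro q hq
  obtain ⟨j, hj, p, hp, hqj, hz, hμ, hν⟩ := decode_of_mem_disc hq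
  have hq1 : q.1 = j := by rw [hqj]
  rw [hq1, hz, hμ, hν]
  have hjm : j ≤ S.P.m + S.P.K := by show j ≤ S.m + S.K; omega
  have hgj : 0 < S.gk j := gk_pos S j
  have hLr : (0 : ℝ) < L := by exact_mod_cast lt_trans zero_lt_one S.hL.2
  have hc : 0 < 𝔠.C68 * (S.gk j * pFun 𝔠.lane.carrier.b₀ 𝔠.lane.carrier.p₀ (S.gk j)) * (((L : ℝ) ^ j)⁻¹) ^ 2 :=
    mul_pos (mul_pos 𝔠.C68_pos (mul_pos hgj (pFun_pos _ _ _ 𝔠.lane.F.b₀_pos hgj (gk_le_one S S.gK_le_one j (by omega)))))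
      (pow_pos (inv_pos.mpr (pow_pos hLr j)) 2)
  refine pdevOn_lt_of_forall hc fun x μ ν hx _ => ?_
  rcases eq_or_ne μ ν with rfl | hμν
  · rw [hol_plaqWord_self, Units.val_one, sub_self, norm_zero]; exact hc
  refine hreg j hj x μ ν hμν (Or.inl ?_)
  have hbox : x ∈ deltaBox (S.P.L ^ j) ((S.P.L ^ j) • zOf p) p.μ p.ν := mem_deltaBox_of_inBox S.P.L j (zOf p) p.μ p.ν hx
  exact (plaqCover_subset_of_admissible 𝔠.lane.carrier.M₁ (rcolOf S 𝔠.lane.carrier) hh hj hp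
    (projSite_mem_plaqCover hjm p hbox)).1

/-- **THE CLASS-I ROWS FROM THE IN-EDGE FACES AND (43)**: `RunRowsI` from `InEdgeFaces 𝔏` and the (43)-form of the data — row by row: `hU` = `measUk`;
`h44`, `hfloor` by `h44_of_form43` ∕ `hfloor_of_form43`; `hLF67` by `hLF67_of_inB42`; `h68` by `h68_of_reg2`. [cite: Balaban1985UV3, (44) p.267 + (67)–(68) p.273] -/
theorem runRowsI_of_faces (h43 : ∀ k, k + 1 ≤ S.K → OldTermForm 𝔊 𝔠 𝔖 𝔏 k) (F : InEdgeFaces 𝔊 𝔠 X 𝔏) :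
    RunRowsI 𝔊 𝔠 X 𝔖 where
  steps k hk :=
    { hU := F.measUk k hk
      h44 := h44_of_form43 k (h43 k hk) (F.loop28 k hk)
      hfloor := hfloor_of_form43 k (h43 k hk) }
  hLF67 k hk h hh U := by
    obtain ⟨V, hV, h42⟩ := F.inB42 k hk h hh U
    exact hLF67_of_inB42 hk hh U hV h42
  h68 k hk h hh U := h68_of_reg2 hk hh U (F.reg2 k hk h hh U)

/-- **THE (α) CLAUSE FROM «DATA SCHEMA ∧ IN-EDGE FACES»**: `RunAlpha 𝔊 𝔠 X 𝔖 𝔄` from `RunDataRows` and `InEdgeFaces` — what remains DISPLAYED of the lane's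
(α) clause, once the in-edges' printed statements are given bodies at its objects, is the cluster-expansion data of classes II + III and (43)'s form.
[cite: Balaban1985UV3, (41) p.266 + (47) p.267 + pp.273–274] -/
theorem runAlpha_of_data_faces (D : RunDataRows 𝔊 𝔠 X 𝔖 𝔄 𝔏) (F : InEdgeFaces 𝔊 𝔠 X 𝔏) : RunAlpha 𝔊 𝔠 X 𝔖 𝔄 :=
  (runAlpha_iff 𝔊 𝔠 X 𝔖 𝔄).2 ⟨D.steps, runRowsI_of_faces D.form43 F⟩

end Faces

/-! ## §5 N08 at the C-binding of record over the constructed family, from «data schema ∧ in-edge faces» (through T4 by name) -/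

section N08

variable {G : Type} [GaugeGroup G] [MeasurableSpace G] [HaarData G] {𝔊 : GroupModel G} {𝔠 : AlphaConsts L 𝔊.N}
  {X : ∀ S : Scales L, ExternalInputs S G}
  {𝔖 : ∀ (S : Scales L) (k : ℕ), StepSeries S G ↥(lieC 𝔊) (nblkOf S 𝔠.lane.carrier k) k}
  {𝔄 : ∀ S : Scales L, AlphaData 𝔊 𝔠 (X S) (𝔖 S)} {𝔏 : ∀ S : Scales L, OldTermSizes S G}
  {Xc : PrintedCarriersR} {Y : PrintedCarriers9X} {Z : PrintedCarriers11} {V : PrintedCarriers14R} {W : PrintedCarriers15}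
  {w : WorldP} {P : B12.RunParams}

/-- **THEOREM 1 (compact reading) ∧ THEOREM 2 FOR THE CONSTRUCTED DENSITIES = THE C-BINDING'S LEAF, from the data schema and the in-edge faces** on the
`≤`-family `S.g²·S.ε₀ ≤ (min γ₀ 1)²` (T4's `b10Compact_constructedLE` ∘ `runAlpha_of_data_faces`). [cite: Balaban1985UV3, Thm 1 p.257 (compact reading) + Thm 2 p.272] -/
theorem b10Compact_constructedLE_of_faces
    (hD : ∀ S : Scales L, S.g ^ 2 * S.ε₀ ≤ (min 𝔠.gamma0 1) ^ 2 → RunDataRows 𝔊 𝔠 (X S) (𝔖 S) (𝔄 S) (𝔏 S))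
    (hF : ∀ S : Scales L, S.g ^ 2 * S.ε₀ ≤ (min 𝔠.gamma0 1) ^ 2 → InEdgeFaces 𝔊 𝔠 (X S) (𝔏 S)) (Xc : PrintedCarriersR) :
    b10Compact (Xc.withTowerRuns10 fun S : ScalesLE L ((min 𝔠.gamma0 1) ^ 2) =>
      towerOf 𝔠.lane (X S.1) (𝔖 S.1)).toPrintedCarriers :=
  b10Compact_constructedLE (fun S hS => runAlpha_of_data_faces (hD S hS) (hF S hS)) Xc

/-- **N08 BY NAME AT THE C-BINDING OF RECORD OVER THE CONSTRUCTED RUN FAMILY, from the data schema and the in-edge faces**: at `w.up P =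
B10CompactBinding.ofPrintedAllXPNC (Xc.withTowerRuns10 (S ↦ towerOf 𝔠.lane (X S) (𝔖 S))) Y Z V W` over `ScalesLE L ((min γ₀ 1)²)`, `Dag.B10_main (leavesP w P)`
(T4's `b10_main_constructedLE_upC`). [cite: Balaban1985UV3, Thm 1 p.257 (compact reading) + Thm 2 p.272] -/
theorem b10_main_constructedLE_upC_of_faces
    (hD : ∀ S : Scales L, S.g ^ 2 * S.ε₀ ≤ (min 𝔠.gamma0 1) ^ 2 → RunDataRows 𝔊 𝔠 (X S) (𝔖 S) (𝔄 S) (𝔏 S))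
    (hF : ∀ S : Scales L, S.g ^ 2 * S.ε₀ ≤ (min 𝔠.gamma0 1) ^ 2 → InEdgeFaces 𝔊 𝔠 (X S) (𝔏 S))
    (hup : w.up P = ofPrintedAllXPNC (Xc.withTowerRuns10 fun S : ScalesLE L ((min 𝔠.gamma0 1) ^ 2) =>
      towerOf 𝔠.lane (X S.1) (𝔖 S.1)) Y Z V W) :
    Dag.B10_main (leavesP w P) :=
  b10_main_constructedLE_upC (fun S hS => runAlpha_of_data_faces (hD S hS) (hF S hS)) hup

/-- **RECORD-PREDICATE FORM WITH THE SPLIT CLAUSE** (the shape of `S_N08 Rec := AtRecord Rec Dag.B10_main` at a C-bound `Rec`, chair R434 (c1) idiom «ESTIMATE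
ASSUMED AS ADMISSIBILITY»): for any predicate `Rec` on binding worlds under which, at every run, SOME constants ∕ external inputs ∕ expansion data ∕ auxiliary
data ∕ (43)-sizes — whose DATA SCHEMA (classes II + III, (43)) and IN-EDGE FACES ([7] (2)∕(3), (44)'s loop input, measurability) hold on the `≤`-family —
bind the upstream as the C-binding over carriers whose B10 runs ARE the constructed family, N08 holds at every `Rec`-world and run.  What is displayed in
`Rec` beyond the in-edges is exactly the cluster-expansion data. [cite: Balaban1985UV3, Thm 1 p.257 (compact reading) + Thm 2 p.272 (bookkeeping shape)] -/
theorem b10_main_at_record_of_facesPin (Rec : WorldP → Prop)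
    (hpin : ∀ w, Rec w → ∀ P : B12.RunParams,
      ∃ (𝔠 : AlphaConsts L 𝔊.N) (X : ∀ S : Scales L, ExternalInputs S G)
        (𝔖 : ∀ (S : Scales L) (k : ℕ), StepSeries S G ↥(lieC 𝔊) (nblkOf S 𝔠.lane.carrier k) k)
        (𝔄 : ∀ S : Scales L, AlphaData 𝔊 𝔠 (X S) (𝔖 S)) (𝔏 : ∀ S : Scales L, OldTermSizes S G)
        (Xc : PrintedCarriersR) (Y : PrintedCarriers9X) (Z : PrintedCarriers11) (V : PrintedCarriers14R) (W : PrintedCarriers15),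
        (∀ S : Scales L, S.g ^ 2 * S.ε₀ ≤ (min 𝔠.gamma0 1) ^ 2 →
            RunDataRows 𝔊 𝔠 (X S) (𝔖 S) (𝔄 S) (𝔏 S) ∧ InEdgeFaces 𝔊 𝔠 (X S) (𝔏 S)) ∧
          w.up P = ofPrintedAllXPNC (Xc.withTowerRuns10 fun S : ScalesLE L ((min 𝔠.gamma0 1) ^ 2) =>
            towerOf 𝔠.lane (X S.1) (𝔖 S.1)) Y Z V W) :
    ∀ w, Rec w → ∀ P, Dag.B10_main (leavesP w P) := by
  intro w hw P
  obtain ⟨𝔠, X, 𝔖, 𝔄, 𝔏, Xc, Y, Z, V, W, hα, hup⟩ := hpin w hw P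
  exact b10_main_constructedLE_upC_of_faces (fun S hS => (hα S hS).1) (fun S hS => (hα S hS).2) hup

end N08

/-! ## §6 (v1.1) The lane's END THEOREM and its literal-reading negative edge from «data schema ∧ in-edge faces» -/

section End

open Literature.MathematicalPhysics.QuantumFieldTheory.Balaban1985CMP102.Theorems (Thm1AsPrintedCompact Thm2AsPrintedC runs)
open Summit.QuantumFields.Balaban3D.Proofs.Constants (eps0Of)

/-- **BAŁABAN CMP 102 (1985), THEOREM 1 (compact reading) ∧ THEOREM 2 FOR THE CONSTRUCTED DENSITIES, FROM «DATA SCHEMA ∧ IN-EDGE FACES»**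
(v1.1): the lane's end theorem `UVStability3DInputs.uvStability3D_of_inputs` with its (α) hypothesis `RunAlpha` REPLACED, for every group as printed
and every lattice approximation of the exhibited family `S.ε₀ = ε₀(S.g)`, by the cluster-expansion data schema `RunDataRows` (classes II + III of
the census, (43) as printed) and the in-edge faces `InEdgeFaces` ([7] (2)∕(3) with body, (44)'s loop input, measurability) — composed through
`runAlpha_of_data_faces`.  Conclusion verbatim: `Thm1AsPrintedCompact (laneT 𝔠 X 𝔖).toConstruction ∧ Thm2AsPrintedC (laneT 𝔠 X 𝔖).toConstruction`.
[cite: Balaban1985UV3, Thm 1 p.257 + Thm 2 p.272 + p.256 L15–18] -/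
theorem uvStability3D_of_data_faces
    (𝔠 : ∀ (G : Type) [GaugeGroup G] [MeasurableSpace G] [HaarData G] (𝔊 : GroupModel G), AlphaConsts L 𝔊.N)
    (X : ∀ (G : Type) [GaugeGroup G] [MeasurableSpace G] [HaarData G], GroupModel G → ∀ S : Scales L, ExternalInputs S G)
    (𝔖 : ∀ (G : Type) [GaugeGroup G] [MeasurableSpace G] [HaarData G] (𝔊 : GroupModel G) (S : Scales L) (k : ℕ),
      StepSeries S G ↥(lieC 𝔊) (nblkOf S (𝔠 G 𝔊).lane.carrier k) k)
    (𝔄 : ∀ (G : Type) [GaugeGroup G] [MeasurableSpace G] [HaarData G] (𝔊 : GroupModel G) (S : Scales L),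
      AlphaData 𝔊 (𝔠 G 𝔊) (X G 𝔊 S) (𝔖 G 𝔊 S))
    (𝔏 : ∀ (G : Type) [GaugeGroup G] [MeasurableSpace G] [HaarData G], GroupModel G → ∀ S : Scales L, OldTermSizes S G)
    (hD : ∀ (G : Type) [GaugeGroup G] [MeasurableSpace G] [HaarData G] (𝔊 : GroupModel G) (S : Scales L),
      S.ε₀ = eps0Of (𝔠 G 𝔊).gamma0 S.g → RunDataRows 𝔊 (𝔠 G 𝔊) (X G 𝔊 S) (𝔖 G 𝔊 S) (𝔄 G 𝔊 S) (𝔏 G 𝔊 S))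
    (hF : ∀ (G : Type) [GaugeGroup G] [MeasurableSpace G] [HaarData G] (𝔊 : GroupModel G) (S : Scales L),
      S.ε₀ = eps0Of (𝔠 G 𝔊).gamma0 S.g → InEdgeFaces 𝔊 (𝔠 G 𝔊) (X G 𝔊 S) (𝔏 G 𝔊 S)) :
    Thm1AsPrintedCompact (laneT 𝔠 X 𝔖).toConstruction ∧ Thm2AsPrintedC (laneT 𝔠 X 𝔖).toConstruction :=
  uvStability3D_of_inputs 𝔠 X 𝔖 𝔄 fun G _ _ _ 𝔊 S hS => runAlpha_of_data_faces (hD G 𝔊 S hS) (hF G 𝔊 S hS)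

/-- **THE LITERAL READING OF THEOREM 1 FAILS ON THE SAME CONSTRUCTED FAMILY, from «data schema ∧ in-edge faces»** (v1.1; G-B10-01): for one group
as printed with `d(𝔤) ≥ 1` whose data schema and in-edge faces hold on the exhibited family, `(Thm1PrintedCompact ∧ Thm2Printed) ∧ ¬ Thm1Printed` on
`Theorems.runs (laneT 𝔠 X 𝔖).toConstruction G 𝔊 (eps0Of γ₀)` — `UVStability3DInputs.not_literal_of_inputs` ∘ `runAlpha_of_data_faces`.
[cite: Balaban1985UV3, Thm 1 p.257 + (62) p.271] -/
theorem not_literal_of_data_faces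
    (𝔠 : ∀ (G : Type) [GaugeGroup G] [MeasurableSpace G] [HaarData G] (𝔊 : GroupModel G), AlphaConsts L 𝔊.N)
    (X : ∀ (G : Type) [GaugeGroup G] [MeasurableSpace G] [HaarData G], GroupModel G → ∀ S : Scales L, ExternalInputs S G)
    (𝔖 : ∀ (G : Type) [GaugeGroup G] [MeasurableSpace G] [HaarData G] (𝔊 : GroupModel G) (S : Scales L) (k : ℕ),
      StepSeries S G ↥(lieC 𝔊) (nblkOf S (𝔠 G 𝔊).lane.carrier k) k)
    (hL : Odd L ∧ 1 < L) (G : Type) [GaugeGroup G] [MeasurableSpace G] [HaarData G] (𝔊 : GroupModel G)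
    (hdim : 1 ≤ (𝔠 G 𝔊).dimg) (𝔄 : ∀ S : Scales L, AlphaData 𝔊 (𝔠 G 𝔊) (X G 𝔊 S) (𝔖 G 𝔊 S))
    (𝔏 : ∀ S : Scales L, OldTermSizes S G)
    (hD : ∀ S : Scales L, S.ε₀ = eps0Of (𝔠 G 𝔊).gamma0 S.g → RunDataRows 𝔊 (𝔠 G 𝔊) (X G 𝔊 S) (𝔖 G 𝔊 S) (𝔄 S) (𝔏 S))
    (hF : ∀ S : Scales L, S.ε₀ = eps0Of (𝔠 G 𝔊).gamma0 S.g → InEdgeFaces 𝔊 (𝔠 G 𝔊) (X G 𝔊 S) (𝔏 S)) :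
    (Thm1PrintedCompact (runs (laneT 𝔠 X 𝔖).toConstruction G 𝔊 (eps0Of (𝔠 G 𝔊).gamma0))
        ∧ Thm2Printed (runs (laneT 𝔠 X 𝔖).toConstruction G 𝔊 (eps0Of (𝔠 G 𝔊).gamma0)))
      ∧ ¬ Thm1Printed (runs (laneT 𝔠 X 𝔖).toConstruction G 𝔊 (eps0Of (𝔠 G 𝔊).gamma0)) :=
  not_literal_of_inputs 𝔠 X 𝔖 hL G 𝔊 hdim 𝔄 fun S hS => runAlpha_of_data_faces (hD S hS) (hF S hS)

end End

end Summit.QuantumFields.YangMills.Theorems.BalabanUVNodesN08AlphaClassIDischarge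

end
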